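import Summits.QuantumFields.YangMills.Theorems.FluctuationComparisonRegPrIntLS2BetaNearSymmetryRigidity
import Summits.QuantumFields.YangMills.Theorems.FluctuationComparisonRegPrIntLS2BetaPosCollarOfLocalGrowth
import Summits.QuantumFields.YangMills.Theorems.FluctuationComparisonRegPrIntLS2BetaOrbitDistComparison
import Summits.QuantumFields.YangMills.Theorems.FluctuationComparisonRegPrIntLS2BetaOrbitGrowthOfRegular
import Summits.QuantumFields.YangMills.Theorems.FluctuationComparisonRegPrIntLS2BetaSignedCombLipschitz
import Summits.QuantumFields.YangMills.Theorems.UnitScaleTiltProp7CritEL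
import HarnessLib

/-!
# S2β · POS∘ — (T7b) POS∘ ∕ TUBE♭ AT PRINT'S REGULAR MINIMISER FROM ORBIT GROWTH **AT AN IRREDUCIBLE DATUM**:
# seam (b) WITHOUT the moved-datum minimiser — per-datum letters {IRR(V), (Lπ)_loc} in place of {(E), (Ls), (Lπ)}

Cell `ym3-torus` (YM ladder rung R3 = continuum `SU(2)` Yang–Mills on the three-torus at fixed lattice data — a RUNG: NOT d = 4, NOT infinite volume,
NOT a mass gap, NOT Clay).  Width seat `ym3-torus-px21` (gen 19), the (T)-chain of LINE g18-1 S2β (✓(T1)–✓(T6) px21 g18, (T7a) `…S2BetaNearSymmetryRigidity`).  Crux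
`stmt-QuantumFields-20520` (`…Theses.UnitScaleTilt.FluctuationComparisonRegPrIntL`); `--kind proof --supports stmt-QuantumFields-20520 --as helper`, count-neutral, DEFINITION-FREE
(0 `def`, 0 `instance`, 0 `notation`, 0 `sorry`, default heartbeats).

WHY.  After ✓pen 3 (px17 `orbitGrowth_of_isCritR2_five`: (142) with its K-uniform rate in orbit-`dist1²` currency over the regular competitors, ZERO hypotheses at `L ≥ 5`),
✓px8 `…S2BetaOrbitDistComparison` and ✓(T6) `…S2BetaPosCollarOfOrbitGrowth`, POS∘∕TUBE♭ at print's regular minimiser per datum was by kernel ⟸ {(E), (Ls), (Lπ), ISOL∘(δ)} —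
(E)+(Ls) being the MOVED-DATUM letters (a minimiser `U₁` over `u↓•V` on the residual orbit of `u•U₀`, Lipschitz in the datum: [Balaban1985Variational] Thm 1's
analyticity half, an EX-cone letter).  THIS FILE removes the moved datum at every datum whose commutant is scalar (IRR(V) — the generic, irreducible datum; the
central-stabiliser stratum of ✓px17 pen 4 `atMostOneCriticalOrbit_of_centralStab_five`, whose token `∀ s, GaugeField.gaugeAct s V = V → s = (fun _ => 1) ∨ s = (fun _ => ⟨-1, neg_one_mem⟩)`
is CITED, not restated): pen 3's fine `u` has `d_J(V, (u⁻¹)↓•V) ≤ Kπ·d(U, u•U₀)` by Lipschitz descent AT THE BASE POINT ((Lπ)_loc, DISPLAYED in J5's sup-norm letter shape —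
✓`Prop7DescendJunction.norm_descendTo_sub_descendTo_le_and_sub_lin_le` after a gauge of the regular `U₀`; the Lipschitz upgrade of (T2d)'s `hcont`); near-symmetry rigidity ((T7a) §2)
puts `(u⁻¹)↓` sitewise near ONE scalar; the residual correction `w := u⁻¹·k⁻¹` ((T7a) §3, `k` = block-constant lift) then has `d(w•U, U₀) ≤ M·d(U, u•U₀)` ((T7a) §1 + ✓px8 §1
triangle rows); so the residual-orbit distance inherits pen 3's row on a neighbourhood of `U₀` with `c ↦ c·ℓ⁻²∕M²`, which is ✓(T4) §1 `posCollar_of_growthOn_nhds`'s socket: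
* ★★★ `growthOn_nhds_at_isCritR2_of_irr_five (L) (h5 : 5 ≤ L) : ∃ e₈>0, ∀ F (F.L=L) J<K e γ b₀ p₀ ε₀ V U₀, 0<e≤e₈ → U₀ ∈ regFibrePr e V → IsCritR2 V U₀ → A U₀ = minActionRegPr ε₀ V →
  hcont → IRR(V) → ∀ ρ₀ Kπ, 0<ρ₀ → 0≤Kπ → (Lπ)_loc(U₀; ρ₀, Kπ) → ∃ N ∈ 𝓝 U₀, ∃ c>0, ⟨intrinsic growth on N⟩`;
* ★★★ `posCollar_at_isCritR2_of_irr_five` — the same ⟹ px8's POS∘ letter (`hpos` of ✓`tubeGrowth_of_pos_of_isolated` ∕ (T3), VERBATIM), every `δ`;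
* ★★★ `tubeGrowth_at_isCritR2_of_irr_of_isolated_five` — + ISOL∘(δ) (the `hisol` text VERBATIM; at a central-stabiliser datum = ✓∕⧗px8 `isol_of_atMostOneCriticalOrbit` ∘ ✓pen 4
  modulo its regime letter) ⟹ TUBE♭(V,U₀) VERBATIM.
CONSTANTS PER DATUM (existential `N`, `c`, `r`, `μ` — through (T7a)'s `K_V`, `#bonds` and `Kπ`), as POS∘ is; `e₈(L)` is pen 3's.  PER-DATUM LETTERS LEFT at an irreducible datum:
{(Lπ)_loc at `U₀`, ISOL∘(δ) (for TUBE♭)} — NO (E), NO (Ls), NO moved-datum minimiser.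

HONEST: composition + kinematics over landed theorems; nothing of Bałaban's analysis beyond the cited tree theorems; (Lπ)_loc (descent Lipschitz at a regular base point),
ISOL∘(δ), the REDUCIBLE stratum (non-central stabiliser — there the route needs ✓pen 4's lifting hypothesis `sameOrbit_of_symmetriesLift_five` made quantitative, not claimed),
TUBE-REG∘ (datum-free δ, K-uniform μ in the organ's quantifier order), GAP♯∘, GAP♭, EXW∘, S2β, crux 20520 NOT proved; at `L = 3` pen 3's Thm-2 socket is open (EMBARGO-LITE №58);
no summit statement is proved by a helper; finite-volume ∕ conditional; rung R3 = SU(2) YM₃ on T³ — NOT d = 4, NOT infinite volume, NOT a mass gap, NOT Clay; the Yang–Mills mass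
gap is NOT proved.  Sorry-free, axioms standard.

References: T. Bałaban, CMP **102** (1985) 277–309 [Balaban1985Variational] ((4)–(6) p.278, Thm 1 (8)–(10) p.279, Prop. 7 and (141)–(143) p.299); CMP **102** (1985) 255–275 [Balaban1985UV3]
((12)–(13) p.259, (18)–(22) p.260); CMP **98** (1985) 17–51 [Balaban1985Averaging] ((8), (11)–(13) p.19, Prop. 5 (156)–(157) p.42); CMP **99** (1985) 75–102 [Balaban1985RegularSpaces] (Thm 2 p.83).
-/

set_option autoImplicit false

noncomputable section

namespace Summit.QuantumFields.YangMills.Theorems.FluctuationComparisonRegPrIntLS2BetaPosCollarAtIrreducible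

open Set Filter Topology Function
open scoped Matrix.Norms.L2Operator
open Literature.MathematicalPhysics.QuantumFieldTheory.Balaban1983to89
open Literature.MathematicalPhysics.QuantumFieldTheory.Balaban1983to89.T3ContinuumYM3Torus
open Literature.MathematicalPhysics.QuantumFieldTheory.Balaban1983to89.T3UnitLawDensityEML (ℰp)
open Literature.MathematicalPhysics.QuantumFieldTheory.Balaban1983to89.T3UnitScaleTilt
open Literature.MathematicalPhysics.QuantumFieldTheory.Balaban1983to89.T3TiltDescent
open Literature.MathematicalPhysics.QuantumFieldTheory.Balaban1983to89.T3ConstrainedMinimiser (fibre)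
open Literature.MathematicalPhysics.QuantumFieldTheory.Balaban1983to89.T3PrintedRegularMinimiser
open Literature.MathematicalPhysics.QuantumFieldTheory.Balaban1983to89.T3PrintedRegularOrbits (descTransf descendTo_gaugeAct liftTransfTo descTransf_liftTransfTo)
open Literature.MathematicalPhysics.QuantumFieldTheory.Balaban1983to89.T3Thm1CarrierNative (IsCritR2)
open Literature.MathematicalPhysics.QuantumFieldTheory.Balaban1983to89.T4Continuum
open scoped Literature.MathematicalPhysics.QuantumFieldTheory.Balaban1983to89.T3OrbitAverage
open Summit.QuantumFields.YangMills.Theorems.FluctuationComparisonRegPrIntLS2BetaResidualGauge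
open Summit.QuantumFields.YangMills.Theorems.FluctuationComparisonRegPrIntLS2BetaPosCollarOfGrowthRow (iInf_orbitDistSq_gaugeAct_left iInf_orbitDistSq_le_sum_one)
open Summit.QuantumFields.YangMills.Theorems.FluctuationComparisonRegPrIntLS2BetaPosCollarCoverOfTubeChart (mem_fibre_of_mem_closure_of_continuousAt)
open Summit.QuantumFields.YangMills.Theorems.FluctuationComparisonRegPrIntLS2BetaPosCollarOfLocalGrowth
open Summit.QuantumFields.YangMills.Theorems.FluctuationComparisonRegPrIntLS2BetaOrbitDistComparison (sum_dist1_sq_gaugeAct sum_dist1_sq_comm sqrt_sum_dist1_sq_triangle)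
open Summit.QuantumFields.YangMills.Theorems.FluctuationComparisonRegPrIntLS2BetaOrbitGrowthOfRegular (orbitGrowth_of_isCritR2_five)
open Summit.QuantumFields.YangMills.Theorems.Prop7CritEL (isOpen_regPr)
open Summit.QuantumFields.YangMills.Theorems.FluctuationComparisonRegPrIntLS2BetaSignedCombLipschitz (dist1_mul_inv_eq_norm_sub)
open Summit.QuantumFields.YangMills.Theorems.FluctuationComparisonRegPrIntLS2BetaNearSymmetryRigidity

/-! ## §4 Near the FULL orbit ⟹ near the RESIDUAL orbit, on a fibre over an irreducible datum -/

section Lift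

variable (F : T3Family) {J K : ℕ} (hJK : J ≤ K)

/-- ★★ **ON A FIBRE OVER AN IRREDUCIBLE DATUM, «NEAR THE FULL GAUGE ORBIT OF `U₀`» IMPLIES «NEAR ITS RESIDUAL ORBIT», LINEARLY.**  Let `U₀, U` lie over the same datum
`V` (`D U₀ = D U = V`), let `K_V` be a near-symmetry-rigidity constant of `V` ((T7a) §2 `exists_near_scalar_of_irr`), let the descent be Lipschitz at `U₀` in sup-norm on the ball
`‖U₀ − B‖_∞ ≤ ρ₀` with constant `Kπ` ((Lπ)_loc, J5's letter shape), and let a FINE gauge transformation `u` have `Σ_ℓ dist1 (U ℓ·((u•U₀) ℓ)⁻¹)² ≤ ρ²` with `0 ≤ ρ ≤ ρ₀`.  Then some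
RESIDUAL `w` has `(Σ_ℓ dist1 ((w•U) ℓ·(U₀ ℓ)⁻¹)²)^{1/2} ≤ (1 + 2·√#bonds_K·K_V·√#bonds_J·Kπ)·ρ`.  Mechanism: `B := u⁻¹•U` is sup-close to `U₀`, so `D B = (u⁻¹)↓•V` is within `Kπ·ρ`
of `V` per bond; rigidity puts `(u⁻¹)↓` sitewise within `K_V·√#bonds_J·Kπ·ρ` of one scalar; the residual correction `w := u⁻¹·k⁻¹` (`k` = block-constant lift, (T7a) §3) then moves
`u⁻¹•U` by at most `2·√#bonds_K` times that ((T7a) §1), and `d(u⁻¹•U, U₀) = d(U, u•U₀) ≤ ρ`.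
[cite: Balaban1985Variational, (4) p.278, Thm 1 (8)-(10) p.279; Balaban1985Averaging, (8) p.19, (11)-(13) p.19, Prop. 5 (157) p.42; Balaban1985RegularSpaces, Thm 2 p.83] -/
theorem exists_residual_near_of_near_orbit_of_irr
    (V : GaugeField (F.P J) 0 (Matrix.specialUnitaryGroup (Fin 2) ℂ)) (U₀ U : GaugeField (F.P K) 0 (Matrix.specialUnitaryGroup (Fin 2) ℂ))
    (hU₀V : descendTo F ℰp J K hJK U₀ = V) (hUV : descendTo F ℰp J K hJK U = V) {KV : ℝ} (hKV : 0 ≤ KV)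
    (HR : ∀ s : Site (F.P J) 0 → Matrix.specialUnitaryGroup (Fin 2) ℂ, ∃ a : ℂ,
      ∀ y, ‖(s y : Matrix (Fin 2) (Fin 2) ℂ) - a • 1‖ ≤ KV * Real.sqrt (∑ b : PBond (F.P J) 0, dist1 ((GaugeField.gaugeAct s V) b * (V b)⁻¹) ^ 2))
    {ρ₀ Kπ : ℝ} (hKπ : 0 ≤ Kπ)
    (hLip : ∀ (B : GaugeField (F.P K) 0 (Matrix.specialUnitaryGroup (Fin 2) ℂ)) (ρ : ℝ), 0 ≤ ρ → ρ ≤ ρ₀ →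
      (∀ ℓ : PBond (F.P K) 0, ‖(U₀ ℓ : Matrix (Fin 2) (Fin 2) ℂ) - (B ℓ : Matrix (Fin 2) (Fin 2) ℂ)‖ ≤ ρ) →
      ∀ b : PBond (F.P J) 0,
        ‖((descendTo F ℰp J K hJK U₀ b : Matrix.specialUnitaryGroup (Fin 2) ℂ) : Matrix (Fin 2) (Fin 2) ℂ) - ((descendTo F ℰp J K hJK B b : Matrix.specialUnitaryGroup (Fin 2) ℂ) : Matrix (Fin 2) (Fin 2) ℂ)‖ ≤ Kπ * ρ)
    (u : Site (F.P K) 0 → Matrix.specialUnitaryGroup (Fin 2) ℂ) {ρ : ℝ} (hρ0 : 0 ≤ ρ) (hρρ₀ : ρ ≤ ρ₀)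
    (hρ : ∑ ℓ : PBond (F.P K) 0, dist1 (U ℓ * ((GaugeField.gaugeAct u U₀) ℓ)⁻¹) ^ 2 ≤ ρ ^ 2) :
    ∃ w : Site (F.P K) 0 → Matrix.specialUnitaryGroup (Fin 2) ℂ,
      (∀ U'' : GaugeField (F.P K) 0 (Matrix.specialUnitaryGroup (Fin 2) ℂ), descendTo F ℰp J K hJK (GaugeField.gaugeAct w U'') = descendTo F ℰp J K hJK U'') ∧
        Real.sqrt (∑ ℓ : PBond (F.P K) 0, dist1 ((GaugeField.gaugeAct w U) ℓ * (U₀ ℓ)⁻¹) ^ 2) ≤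
          (1 + 2 * Real.sqrt (Fintype.card (PBond (F.P K) 0) : ℝ) * (KV * (Real.sqrt (Fintype.card (PBond (F.P J) 0) : ℝ) * Kπ))) * ρ := by
  obtain ⟨nK, hnK⟩ : ∃ nK : ℝ, nK = (Fintype.card (PBond (F.P K) 0) : ℝ) := ⟨_, rfl⟩
  obtain ⟨nJ, hnJ⟩ : ∃ nJ : ℝ, nJ = (Fintype.card (PBond (F.P J) 0) : ℝ) := ⟨_, rfl⟩
  have hnK0 : 0 ≤ nK := by rw [hnK]; exact Nat.cast_nonneg _
  have hnJ0 : 0 ≤ nJ := by rw [hnJ]; exact Nat.cast_nonneg _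
  rw [← hnK, ← hnJ]
  -- the comparison configuration `B := u⁻¹ • U`, sup-close to `U₀`
  obtain ⟨ũ, hũ⟩ : ∃ ũ : Site (F.P K) 0 → Matrix.specialUnitaryGroup (Fin 2) ℂ, ũ = fun x => (u x)⁻¹ := ⟨_, rfl⟩
  obtain ⟨B, hB⟩ : ∃ B : GaugeField (F.P K) 0 (Matrix.specialUnitaryGroup (Fin 2) ℂ), B = GaugeField.gaugeAct ũ U := ⟨_, rfl⟩
  have huB : GaugeField.gaugeAct u B = U := by
    rw [hB, hũ]; exact gaugeAct_gaugeAct_inv (u : Site (F.P K) 0 → Matrix.specialUnitaryGroup (Fin 2) ℂ) U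
  have hũU₀ : GaugeField.gaugeAct ũ (GaugeField.gaugeAct u U₀) = U₀ := by
    rw [hũ]; exact gaugeAct_inv_gaugeAct (u : Site (F.P K) 0 → Matrix.specialUnitaryGroup (Fin 2) ℂ) U₀
  have hdB : ∑ ℓ : PBond (F.P K) 0, dist1 (U₀ ℓ * (B ℓ)⁻¹) ^ 2 ≤ ρ ^ 2 := by
    rw [← sum_dist1_sq_gaugeAct u U₀ B, huB, sum_dist1_sq_comm]; exact hρ
  have hsupB : ∀ ℓ : PBond (F.P K) 0, ‖(U₀ ℓ : Matrix (Fin 2) (Fin 2) ℂ) - (B ℓ : Matrix (Fin 2) (Fin 2) ℂ)‖ ≤ ρ := by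
    intro ℓ
    rw [← dist1_mul_inv_eq_norm_sub]
    refine (Real.le_sqrt_of_sq_le ?_).trans (le_of_eq (Real.sqrt_sq hρ0))
    exact (Finset.single_le_sum (f := fun ℓ => dist1 (U₀ ℓ * (B ℓ)⁻¹) ^ 2) (fun ℓ _ => sq_nonneg _) (Finset.mem_univ ℓ)).trans hdB
  -- (Lπ)_loc at the pair `(U₀, B)`: the descended datum moves by at most `Kπ·ρ` per bond
  obtain ⟨s, hsdef⟩ : ∃ s : Site (F.P J) 0 → Matrix.specialUnitaryGroup (Fin 2) ℂ, s = descTransf F J K hJK ũ := ⟨_, rfl⟩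
  have hdescB : descendTo F ℰp J K hJK B = GaugeField.gaugeAct s V := by
    rw [hB, descendTo_gaugeAct, hUV, hsdef]
  have hLipB := hLip B ρ hρ0 hρρ₀ hsupB
  have hdJ : ∑ b : PBond (F.P J) 0, dist1 ((GaugeField.gaugeAct s V) b * (V b)⁻¹) ^ 2 ≤ nJ * (Kπ * ρ) ^ 2 := by
    have hterm : ∀ b : PBond (F.P J) 0, dist1 ((GaugeField.gaugeAct s V) b * (V b)⁻¹) ^ 2 ≤ (Kπ * ρ) ^ 2 := by
      intro b
      refine pow_le_pow_left₀ (GaugeGroup.dist1_nonneg _) ?_ 2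
      have h1 := hLipB b
      rw [hU₀V, hdescB, ← dist1_mul_inv_eq_norm_sub] at h1
      rwa [B11GaugeGlue.dist1_mul_inv_comm] at h1
    calc ∑ b : PBond (F.P J) 0, dist1 ((GaugeField.gaugeAct s V) b * (V b)⁻¹) ^ 2
        ≤ ∑ _b : PBond (F.P J) 0, (Kπ * ρ) ^ 2 := Finset.sum_le_sum fun b _ => hterm b
      _ = nJ * (Kπ * ρ) ^ 2 := by rw [Finset.sum_const, Finset.card_univ, nsmul_eq_mul, hnJ]
  -- (T7a) §2: `s` is sitewise near one scalar
  obtain ⟨a, ha⟩ := HR s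
  obtain ⟨η, hη⟩ : ∃ η : ℝ, η = KV * (Real.sqrt nJ * Kπ) * ρ := ⟨_, rfl⟩
  have hη0 : 0 ≤ η := by rw [hη]; positivity
  have hsη : ∀ y, ‖(s y : Matrix (Fin 2) (Fin 2) ℂ) - a • 1‖ ≤ η := by
    intro y
    refine (ha y).trans ?_
    have h1 : Real.sqrt (∑ b : PBond (F.P J) 0, dist1 ((GaugeField.gaugeAct s V) b * (V b)⁻¹) ^ 2) ≤ Real.sqrt nJ * Kπ * ρ := by
      refine (Real.sqrt_le_sqrt hdJ).trans (le_of_eq ?_)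
      rw [Real.sqrt_mul hnJ0, Real.sqrt_sq (by positivity), mul_assoc]
    calc KV * Real.sqrt (∑ b : PBond (F.P J) 0, dist1 ((GaugeField.gaugeAct s V) b * (V b)⁻¹) ^ 2)
        ≤ KV * (Real.sqrt nJ * Kπ * ρ) := mul_le_mul_of_nonneg_left h1 hKV
      _ = η := by rw [hη]; ring
  -- (T7a) §3: the block-constant lift `k` and the residual `w := ũ·k⁻¹`
  obtain ⟨k, hk⟩ : ∃ k : Site (F.P K) 0 → Matrix.specialUnitaryGroup (Fin 2) ℂ, k = liftTransfTo F J K hJK s := ⟨_, rfl⟩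
  have hkη : ∀ z, ‖(k z : Matrix (Fin 2) (Fin 2) ℂ) - a • 1‖ ≤ η := fun z => by rw [hk]; exact norm_liftTransfTo_sub_smul_one_le F hJK s a hsη z
  obtain ⟨w, hw⟩ : ∃ w : Site (F.P K) 0 → Matrix.specialUnitaryGroup (Fin 2) ℂ, w = fun x => ũ x * (k x)⁻¹ := ⟨_, rfl⟩
  have hwres : ∀ U'' : GaugeField (F.P K) 0 (Matrix.specialUnitaryGroup (Fin 2) ℂ),
      descendTo F ℰp J K hJK (GaugeField.gaugeAct w U'') = descendTo F ℰp J K hJK U'' := by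
    rw [hw, hk, hsdef]; exact residual_mul_inv_liftTransfTo F hJK ũ
  refine ⟨w, hwres, ?_⟩
  -- `w • U = ũ • (k⁻¹ • U)` and its distance to `U₀`
  have hwU : GaugeField.gaugeAct w U = GaugeField.gaugeAct ũ (GaugeField.gaugeAct (k⁻¹ : Site (F.P K) 0 → Matrix.specialUnitaryGroup (Fin 2) ℂ) U) := by
    rw [← gaugeAct_mul_eq, hw]; rfl
  obtain ⟨S1, hS1⟩ : ∃ S1 : ℝ, S1 = ∑ ℓ : PBond (F.P K) 0,
      dist1 ((GaugeField.gaugeAct ũ (GaugeField.gaugeAct (k⁻¹ : Site (F.P K) 0 → Matrix.specialUnitaryGroup (Fin 2) ℂ) U)) ℓ * ((GaugeField.gaugeAct ũ U) ℓ)⁻¹) ^ 2 := ⟨_, rfl⟩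
  have hk1 : S1 ≤ 4 * nK * η ^ 2 := by
    rw [hS1, sum_dist1_sq_gaugeAct ũ]
    have h1 := sum_dist1_sq_gaugeAct_le_of_near_scalar k a hkη (GaugeField.gaugeAct (k⁻¹ : Site (F.P K) 0 → Matrix.specialUnitaryGroup (Fin 2) ℂ) U)
    rw [gaugeAct_gaugeAct_inv] at h1
    rwa [sum_dist1_sq_comm, hnK]
  obtain ⟨S2, hS2⟩ : ∃ S2 : ℝ, S2 = ∑ ℓ : PBond (F.P K) 0, dist1 ((GaugeField.gaugeAct ũ U) ℓ * (U₀ ℓ)⁻¹) ^ 2 := ⟨_, rfl⟩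
  have hk2 : S2 ≤ ρ ^ 2 := by
    rw [hS2]
    conv_lhs => rw [← hũU₀]
    rw [sum_dist1_sq_gaugeAct ũ U (GaugeField.gaugeAct u U₀)]
    exact hρ
  have htri : Real.sqrt (∑ ℓ : PBond (F.P K) 0, dist1 ((GaugeField.gaugeAct w U) ℓ * (U₀ ℓ)⁻¹) ^ 2) ≤ Real.sqrt S1 + Real.sqrt S2 := by
    have h := sqrt_sum_dist1_sq_triangle (GaugeField.gaugeAct ũ (GaugeField.gaugeAct (k⁻¹ : Site (F.P K) 0 → Matrix.specialUnitaryGroup (Fin 2) ℂ) U)) (GaugeField.gaugeAct ũ U) U₀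
    rw [← hS1, ← hS2, ← hwU] at h
    exact h
  have hsq1 : Real.sqrt S1 ≤ 2 * Real.sqrt nK * η := by
    refine (Real.sqrt_le_sqrt hk1).trans (le_of_eq ?_)
    rw [show (4 : ℝ) * nK * η ^ 2 = (2 * Real.sqrt nK * η) ^ 2 by rw [mul_pow, mul_pow, Real.sq_sqrt hnK0]; ring]
    exact Real.sqrt_sq (by positivity)
  have hsq2 : Real.sqrt S2 ≤ ρ := (Real.sqrt_le_sqrt hk2).trans (le_of_eq (Real.sqrt_sq hρ0))
  calc Real.sqrt (∑ ℓ : PBond (F.P K) 0, dist1 ((GaugeField.gaugeAct w U) ℓ * (U₀ ℓ)⁻¹) ^ 2)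
      ≤ Real.sqrt S1 + Real.sqrt S2 := htri
    _ ≤ 2 * Real.sqrt nK * η + ρ := add_le_add hsq1 hsq2
    _ = (1 + 2 * Real.sqrt nK * (KV * (Real.sqrt nJ * Kπ))) * ρ := by rw [hη]; ring

end Lift

/-! ## §5 Intrinsic local growth, POS∘ and TUBE♭ at print's regular minimiser over an irreducible datum -/

section Assembly

/-- ★★★ **INTRINSIC LOCAL GROWTH AT PRINT'S REGULAR MINIMISER OVER AN IRREDUCIBLE DATUM, FROM ORBIT GROWTH — (T4) §1's socket filled per datum at every `L ≥ 5`.**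
For every block size `L ≥ 5` there is `e₈ > 0` (pen 3's) such that: at every member `(F, J < K)`, every datum `V` whose commutant is scalar (IRR(V) — the generic, irreducible datum;
print's central-stabiliser stratum of ✓pen 4 `atMostOneCriticalOrbit_of_centralStab_five`), every base point `U₀ ∈ regFibrePr e V` (`0 < e ≤ e₈`) that is R2-critical and realises
`minActionRegPr ε₀ V`, with `descendTo` continuous near `U₀` ((T2d)) and LIPSCHITZ AT `U₀` in J5's sup-norm letter shape ((Lπ)_loc: `‖U₀ − B‖_∞ ≤ ρ ≤ ρ₀ ⇒ ‖D U₀ − D B‖_∞ ≤ Kπ·ρ`),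
there are a neighbourhood `N` of `U₀` and `c > 0` with `c·⨅_{w residual} Σ_ℓ dist1 (U ℓ·((w•U₀) ℓ)⁻¹)² ≤ A U − minActionRegPr ε₀ V` for every `U ∈ N ∩ closure (fibre V ∩ histGood)`.
MECHANISM: pen 3 ✓`orbitGrowth_of_isCritR2_five` gives a FINE `u` with `c·ℓ⁻²·d(U,u•U₀)² ≤ A U − A U₀` (small on `N`, so `d(U,u•U₀) ≤ ρ₀`); §4 turns it into a RESIDUAL `w` with
`d(w•U, U₀) ≤ M·d(U, u•U₀)`; the residual-orbit distance inherits pen 3's row with `c ↦ c·ℓ⁻²∕M²`.  Constants PER DATUM (existential), as POS∘ is; NO moved-datum minimiser, NO (E), NO (Ls).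
[cite: Balaban1985Variational, Thm 1 (8)-(10) p.279, (141)-(143) p.299, (4) p.278; Balaban1985Averaging, (8) p.19, (11)-(13) p.19, Prop. 5 (157) p.42; Balaban1985RegularSpaces, Thm 2 p.83] -/
theorem growthOn_nhds_at_isCritR2_of_irr_five (L : ℕ) (h5 : 5 ≤ L) :
    ∃ e₈ : ℝ, 0 < e₈ ∧
      ∀ (F : T3Family), F.L = L → ∀ (J K : ℕ) (hJK : J < K) (e γ b₀ p₀ ε₀ : ℝ)
        (V : GaugeField (F.P J) 0 (Matrix.specialUnitaryGroup (Fin 2) ℂ)) (U₀ : GaugeField (F.P K) 0 (Matrix.specialUnitaryGroup (Fin 2) ℂ)),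
        0 < e → e ≤ e₈ → U₀ ∈ regFibrePr F J K hJK.le e V → IsCritR2 F J K hJK.le V U₀ →
        wilsonAction4 U₀ = minActionRegPr F J K hJK.le ε₀ V →
        (∀ᶠ W in 𝓝 U₀, ContinuousAt (descendTo F ℰp J K hJK.le) W) →
        (∀ s : Site (F.P J) 0 → Matrix (Fin 2) (Fin 2) ℂ,
          (∀ b : PBond (F.P J) 0, s b.src * (V b : Matrix (Fin 2) (Fin 2) ℂ) = (V b : Matrix (Fin 2) (Fin 2) ℂ) * s b.tgt) →
            ∃ c : ℂ, ∀ x, s x = c • (1 : Matrix (Fin 2) (Fin 2) ℂ)) →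
        ∀ (ρ₀ Kπ : ℝ), 0 < ρ₀ → 0 ≤ Kπ →
        (∀ (B : GaugeField (F.P K) 0 (Matrix.specialUnitaryGroup (Fin 2) ℂ)) (ρ : ℝ), 0 ≤ ρ → ρ ≤ ρ₀ →
          (∀ ℓ : PBond (F.P K) 0, ‖(U₀ ℓ : Matrix (Fin 2) (Fin 2) ℂ) - (B ℓ : Matrix (Fin 2) (Fin 2) ℂ)‖ ≤ ρ) →
          ∀ b : PBond (F.P J) 0,
            ‖((descendTo F ℰp J K hJK.le U₀ b : Matrix.specialUnitaryGroup (Fin 2) ℂ) : Matrix (Fin 2) (Fin 2) ℂ) -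
                ((descendTo F ℰp J K hJK.le B b : Matrix.specialUnitaryGroup (Fin 2) ℂ) : Matrix (Fin 2) (Fin 2) ℂ)‖ ≤ Kπ * ρ) →
        ∃ N ∈ 𝓝 U₀, ∃ c : ℝ, 0 < c ∧
          ∀ U ∈ closure (fibre F ℰp J K hJK.le V ∩ histGood F ℰp (θBal F.L γ b₀ p₀) K J), U ∈ N →
            c * (⨅ w : {w : Site (F.P K) 0 → Matrix.specialUnitaryGroup (Fin 2) ℂ |
                  ∀ U : GaugeField (F.P K) 0 (Matrix.specialUnitaryGroup (Fin 2) ℂ),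
                    descendTo F ℰp J K hJK.le (GaugeField.gaugeAct w U) = descendTo F ℰp J K hJK.le U},
                ∑ ℓ : PBond (F.P K) 0,
                  dist1 (U ℓ * ((GaugeField.gaugeAct (w : Site (F.P K) 0 → Matrix.specialUnitaryGroup (Fin 2) ℂ) U₀) ℓ)⁻¹) ^ 2)
              ≤ wilsonAction4 U - minActionRegPr F J K hJK.le ε₀ V := by
  obtain ⟨e₈, c, he₈, hc, HG⟩ := orbitGrowth_of_isCritR2_five L h5
  refine ⟨e₈, he₈, ?_⟩
  intro F hF J K hJK e γ b₀ p₀ ε₀ V U₀ he heε hU₀reg hcrit hmin hcont hirr ρ₀ Kπ hρ₀ hKπ hLip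
  -- per-datum constants
  obtain ⟨KV, hKV, HR⟩ := exists_near_scalar_of_irr F V hirr
  have hL1 : (1 : ℝ) < (F.L : ℝ) := by have := F.hL.2; exact_mod_cast (by omega : 1 < F.L)
  obtain ⟨cℓ, hcℓ⟩ : ∃ cℓ : ℝ, cℓ = c * (((F.L : ℝ) ^ (K - J)) ^ 2)⁻¹ := ⟨_, rfl⟩
  have hcℓ0 : 0 < cℓ := by rw [hcℓ]; exact mul_pos hc (inv_pos.mpr (by positivity))
  obtain ⟨M, hM⟩ : ∃ M : ℝ, M = 1 + 2 * Real.sqrt (Fintype.card (PBond (F.P K) 0) : ℝ) *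
      (KV * (Real.sqrt (Fintype.card (PBond (F.P J) 0) : ℝ) * Kπ)) := ⟨_, rfl⟩
  have hM0 : 0 < M := by
    have : 0 ≤ 2 * Real.sqrt (Fintype.card (PBond (F.P K) 0) : ℝ) * (KV * (Real.sqrt (Fintype.card (PBond (F.P J) 0) : ℝ) * Kπ)) := by positivity
    rw [hM]; linarith
  -- the neighbourhood: regular ∩ continuity of the descent ∩ small action increment
  have hU₀fib : U₀ ∈ fibre F ℰp J K hJK.le V := ((mem_regFibrePr_iff F).1 hU₀reg).1
  have hU₀V : descendTo F ℰp J K hJK.le U₀ = V := hU₀fib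
  have hreg0 : U₀ ∈ {U : GaugeField (F.P K) 0 (Matrix.specialUnitaryGroup (Fin 2) ℂ) | RegPr F J K e U} := ((mem_regFibrePr_iff F).1 hU₀reg).2
  have hAopen : IsOpen {U : GaugeField (F.P K) 0 (Matrix.specialUnitaryGroup (Fin 2) ℂ) | wilsonAction4 U < wilsonAction4 U₀ + cℓ * ρ₀ ^ 2} :=
    isOpen_lt (B16Thm1BaseAtRecord11.continuous_wilsonAction4_SU (N := 2) (F.P K) 0) continuous_const
  have hA0 : U₀ ∈ {U : GaugeField (F.P K) 0 (Matrix.specialUnitaryGroup (Fin 2) ℂ) | wilsonAction4 U < wilsonAction4 U₀ + cℓ * ρ₀ ^ 2} := by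
    show wilsonAction4 U₀ < wilsonAction4 U₀ + cℓ * ρ₀ ^ 2
    have : 0 < cℓ * ρ₀ ^ 2 := by positivity
    linarith
  have hN : ({U : GaugeField (F.P K) 0 (Matrix.specialUnitaryGroup (Fin 2) ℂ) | RegPr F J K e U} ∩
      {W | ContinuousAt (descendTo F ℰp J K hJK.le) W} ∩
      {U | wilsonAction4 U < wilsonAction4 U₀ + cℓ * ρ₀ ^ 2}) ∈ 𝓝 U₀ :=
    inter_mem (inter_mem ((isOpen_regPr F J K e).mem_nhds hreg0) hcont) (hAopen.mem_nhds hA0)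
  refine ⟨_, hN, cℓ / M ^ 2, div_pos hcℓ0 (by positivity), ?_⟩
  intro U hUcl hUN
  obtain ⟨⟨hUreg', hUcont⟩, hUA⟩ := hUN
  -- a near point of the closed good fibre is a regular competitor
  have hUf : U ∈ fibre F ℰp J K hJK.le V := mem_fibre_of_mem_closure_of_continuousAt F hJK.le (closure_mono inter_subset_left hUcl) hUcont
  have hUV : descendTo F ℰp J K hJK.le U = V := hUf
  have hUreg : U ∈ regFibrePr F J K hJK.le e V := (mem_regFibrePr_iff F).2 ⟨hUf, hUreg'⟩
  -- pen 3: the fine gauge `u` and the growth row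
  obtain ⟨u, hgrow⟩ := HG F hF J K hJK e V U₀ he heε hU₀reg hcrit U hUreg
  obtain ⟨ρsq, hρsq⟩ : ∃ ρsq : ℝ, ρsq = ∑ ℓ : PBond (F.P K) 0, dist1 (U ℓ * ((GaugeField.gaugeAct u U₀) ℓ)⁻¹) ^ 2 := ⟨_, rfl⟩
  have hρsq0 : 0 ≤ ρsq := by rw [hρsq]; exact Finset.sum_nonneg fun ℓ _ => sq_nonneg _
  obtain ⟨ρ, hρ⟩ : ∃ ρ : ℝ, ρ = Real.sqrt ρsq := ⟨_, rfl⟩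
  have hρ0 : 0 ≤ ρ := by rw [hρ]; exact Real.sqrt_nonneg _
  have hρ2 : ρ ^ 2 = ρsq := by rw [hρ]; exact Real.sq_sqrt hρsq0
  have hgrow' : cℓ * ρsq ≤ wilsonAction4 U - wilsonAction4 U₀ := by rw [hcℓ, hρsq]; exact hgrow
  -- `ρ ≤ ρ₀` from the small action increment
  have hρρ₀ : ρ ≤ ρ₀ := by
    have h1 : cℓ * ρsq < cℓ * ρ₀ ^ 2 := by have := hUA.out; linarith
    have h2 : ρsq < ρ₀ ^ 2 := lt_of_mul_lt_mul_left h1 hcℓ0.le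
    have h3 : ρ ^ 2 < ρ₀ ^ 2 := by rw [hρ2]; exact h2
    exact le_of_lt (by nlinarith [hρ0, hρ₀])
  -- §4: a residual `w` with `d(w•U, U₀) ≤ M·ρ`
  obtain ⟨w, hwres, hdist⟩ := exists_residual_near_of_near_orbit_of_irr F hJK.le V U₀ U hU₀V hUV hKV HR hKπ hLip
    (u : Site (F.P K) 0 → Matrix.specialUnitaryGroup (Fin 2) ℂ) hρ0 hρρ₀ (by rw [hρ2, hρsq])
  rw [← hM] at hdist
  -- the residual-orbit distance of `U` to `U₀` is at most `(M·ρ)²`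
  have hD : (⨅ w' : {w : Site (F.P K) 0 → Matrix.specialUnitaryGroup (Fin 2) ℂ |
        ∀ U : GaugeField (F.P K) 0 (Matrix.specialUnitaryGroup (Fin 2) ℂ),
          descendTo F ℰp J K hJK.le (GaugeField.gaugeAct w U) = descendTo F ℰp J K hJK.le U},
      ∑ ℓ : PBond (F.P K) 0,
        dist1 (U ℓ * ((GaugeField.gaugeAct (w' : Site (F.P K) 0 → Matrix.specialUnitaryGroup (Fin 2) ℂ) U₀) ℓ)⁻¹) ^ 2) ≤ (M * ρ) ^ 2 := by
    rw [← iInf_orbitDistSq_gaugeAct_left F hJK.le hwres U U₀]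
    refine (iInf_orbitDistSq_le_sum_one F hJK.le _ _).trans ?_
    obtain ⟨S, hS⟩ : ∃ S : ℝ, S = ∑ ℓ : PBond (F.P K) 0, dist1 ((GaugeField.gaugeAct w U) ℓ * (U₀ ℓ)⁻¹) ^ 2 := ⟨_, rfl⟩
    rw [← hS] at hdist ⊢
    have h0 : 0 ≤ S := by rw [hS]; exact Finset.sum_nonneg fun ℓ _ => sq_nonneg _
    calc S = Real.sqrt S ^ 2 := (Real.sq_sqrt h0).symm
      _ ≤ (M * ρ) ^ 2 := pow_le_pow_left₀ (Real.sqrt_nonneg _) hdist 2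
  -- conclusion
  rw [← hmin]
  calc cℓ / M ^ 2 * (⨅ w' : {w : Site (F.P K) 0 → Matrix.specialUnitaryGroup (Fin 2) ℂ |
          ∀ U : GaugeField (F.P K) 0 (Matrix.specialUnitaryGroup (Fin 2) ℂ),
            descendTo F ℰp J K hJK.le (GaugeField.gaugeAct w U) = descendTo F ℰp J K hJK.le U},
        ∑ ℓ : PBond (F.P K) 0,
          dist1 (U ℓ * ((GaugeField.gaugeAct (w' : Site (F.P K) 0 → Matrix.specialUnitaryGroup (Fin 2) ℂ) U₀) ℓ)⁻¹) ^ 2)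
      ≤ cℓ / M ^ 2 * (M * ρ) ^ 2 := mul_le_mul_of_nonneg_left hD (div_nonneg hcℓ0.le (by positivity))
    _ = cℓ * ρsq := by rw [mul_pow, hρ2]; field_simp
    _ ≤ wilsonAction4 U - wilsonAction4 U₀ := hgrow'

/-- ★★★ **POS∘ AT PRINT'S REGULAR MINIMISER OVER AN IRREDUCIBLE DATUM, FROM ORBIT GROWTH** — ✓(T4) §1 `posCollar_of_growthOn_nhds` ∘ `growthOn_nhds_at_isCritR2_of_irr_five`.  Same `e₈(L)`;
at every member, irreducible datum `V`, R2-critical `U₀ ∈ regFibrePr e V` realising `minActionRegPr ε₀ V` with `descendTo` continuous near and Lipschitz at `U₀`, px8's POS∘ letter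
(`hpos` of ✓`tubeGrowth_of_pos_of_isolated`, (T3) VERBATIM) holds for every tube radius `δ`.  Seam (b) closes here WITHOUT (E) and WITHOUT (Ls): per-datum letters = {IRR(V), (Lπ)_loc}.
[cite: Balaban1985Variational, Thm 1 (8)-(10) p.279, (141)-(143) p.299; Balaban1985UV3, (12)-(13) p.259; Balaban1985Averaging, Prop. 5 (157) p.42] -/
theorem posCollar_at_isCritR2_of_irr_five (L : ℕ) (h5 : 5 ≤ L) :
    ∃ e₈ : ℝ, 0 < e₈ ∧
      ∀ (F : T3Family), F.L = L → ∀ (J K : ℕ) (hJK : J < K) (e γ b₀ p₀ ε₀ : ℝ)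
        (V : GaugeField (F.P J) 0 (Matrix.specialUnitaryGroup (Fin 2) ℂ)) (U₀ : GaugeField (F.P K) 0 (Matrix.specialUnitaryGroup (Fin 2) ℂ)) (δ : ℝ),
        0 < e → e ≤ e₈ → U₀ ∈ regFibrePr F J K hJK.le e V → IsCritR2 F J K hJK.le V U₀ →
        wilsonAction4 U₀ = minActionRegPr F J K hJK.le ε₀ V →
        (∀ᶠ W in 𝓝 U₀, ContinuousAt (descendTo F ℰp J K hJK.le) W) →
        (∀ s : Site (F.P J) 0 → Matrix (Fin 2) (Fin 2) ℂ,
          (∀ b : PBond (F.P J) 0, s b.src * (V b : Matrix (Fin 2) (Fin 2) ℂ) = (V b : Matrix (Fin 2) (Fin 2) ℂ) * s b.tgt) →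
            ∃ c : ℂ, ∀ x, s x = c • (1 : Matrix (Fin 2) (Fin 2) ℂ)) →
        ∀ (ρ₀ Kπ : ℝ), 0 < ρ₀ → 0 ≤ Kπ →
        (∀ (B : GaugeField (F.P K) 0 (Matrix.specialUnitaryGroup (Fin 2) ℂ)) (ρ : ℝ), 0 ≤ ρ → ρ ≤ ρ₀ →
          (∀ ℓ : PBond (F.P K) 0, ‖(U₀ ℓ : Matrix (Fin 2) (Fin 2) ℂ) - (B ℓ : Matrix (Fin 2) (Fin 2) ℂ)‖ ≤ ρ) →
          ∀ b : PBond (F.P J) 0,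
            ‖((descendTo F ℰp J K hJK.le U₀ b : Matrix.specialUnitaryGroup (Fin 2) ℂ) : Matrix (Fin 2) (Fin 2) ℂ) -
                ((descendTo F ℰp J K hJK.le B b : Matrix.specialUnitaryGroup (Fin 2) ℂ) : Matrix (Fin 2) (Fin 2) ℂ)‖ ≤ Kπ * ρ) →
        ∃ r c : ℝ, 0 < r ∧ 0 < c ∧
          ∀ U ∈ closure (fibre F ℰp J K hJK.le V ∩ histGood F ℰp (θBal F.L γ b₀ p₀) K J),
            (∃ w : Site (F.P K) 0 → Matrix.specialUnitaryGroup (Fin 2) ℂ,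
              (∀ U'' : GaugeField (F.P K) 0 (Matrix.specialUnitaryGroup (Fin 2) ℂ),
                  descendTo F ℰp J K hJK.le (GaugeField.gaugeAct w U'') = descendTo F ℰp J K hJK.le U'') ∧
                ∀ ℓ : PBond (F.P K) 0, dist1 (U ℓ * ((GaugeField.gaugeAct w U₀) ℓ)⁻¹) ≤ δ) →
            (⨅ w : {w : Site (F.P K) 0 → Matrix.specialUnitaryGroup (Fin 2) ℂ |
                ∀ U : GaugeField (F.P K) 0 (Matrix.specialUnitaryGroup (Fin 2) ℂ),
                  descendTo F ℰp J K hJK.le (GaugeField.gaugeAct w U) = descendTo F ℰp J K hJK.le U},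
              ∑ ℓ : PBond (F.P K) 0,
                dist1 (U ℓ * ((GaugeField.gaugeAct (w : Site (F.P K) 0 → Matrix.specialUnitaryGroup (Fin 2) ℂ) U₀) ℓ)⁻¹) ^ 2) ≤ r →
            c * (⨅ w : {w : Site (F.P K) 0 → Matrix.specialUnitaryGroup (Fin 2) ℂ |
                ∀ U : GaugeField (F.P K) 0 (Matrix.specialUnitaryGroup (Fin 2) ℂ),
                  descendTo F ℰp J K hJK.le (GaugeField.gaugeAct w U) = descendTo F ℰp J K hJK.le U},
              ∑ ℓ : PBond (F.P K) 0,
                dist1 (U ℓ * ((GaugeField.gaugeAct (w : Site (F.P K) 0 → Matrix.specialUnitaryGroup (Fin 2) ℂ) U₀) ℓ)⁻¹) ^ 2)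
              ≤ wilsonAction4 U - minActionRegPr F J K hJK.le ε₀ V := by
  obtain ⟨e₈, he₈, H⟩ := growthOn_nhds_at_isCritR2_of_irr_five L h5
  refine ⟨e₈, he₈, ?_⟩
  intro F hF J K hJK e γ b₀ p₀ ε₀ V U₀ δ he heε hU₀reg hcrit hmin hcont hirr ρ₀ Kπ hρ₀ hKπ hLip
  obtain ⟨N, hN, c, hc, hgrowN⟩ := H F hF J K hJK e γ b₀ p₀ ε₀ V U₀ he heε hU₀reg hcrit hmin hcont hirr ρ₀ Kπ hρ₀ hKπ hLip
  exact posCollar_of_growthOn_nhds F hJK.le V U₀ δ hN hc hgrowN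

/-- ★★★ **TUBE♭(V,U₀) AT PRINT'S REGULAR MINIMISER OVER AN IRREDUCIBLE DATUM ⟸ {IRR(V), (Lπ)_loc, ISOL∘(δ)}** — ✓(T4) §1 `tubeGrowth_of_growthOn_nhds_of_isolated` ∘
`growthOn_nhds_at_isCritR2_of_irr_five` (ISOL∘(δ) = the `hisol` text of ✓px8 `tubeGrowth_of_pos_of_isolated` ∕ (T3) :111–121 VERBATIM; at a datum with central stabiliser it is
✓∕⧗px8 `isol_of_atMostOneCriticalOrbit` ∘ ✓pen 4 `atMostOneCriticalOrbit_of_centralStab_five` modulo its regime letter).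
[cite: Balaban1985Variational, Thm 1 (8)-(10) p.279, (141)-(143) p.299; Balaban1985UV3, (12)-(13) p.259 and (18)-(22) p.260; Balaban1985Averaging, Prop. 5 (157) p.42] -/
theorem tubeGrowth_at_isCritR2_of_irr_of_isolated_five (L : ℕ) (h5 : 5 ≤ L) :
    ∃ e₈ : ℝ, 0 < e₈ ∧
      ∀ (F : T3Family), F.L = L → ∀ (J K : ℕ) (hJK : J < K) (e γ b₀ p₀ ε₀ : ℝ)
        (V : GaugeField (F.P J) 0 (Matrix.specialUnitaryGroup (Fin 2) ℂ)) (U₀ : GaugeField (F.P K) 0 (Matrix.specialUnitaryGroup (Fin 2) ℂ)) (δ : ℝ),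
        0 < e → e ≤ e₈ → U₀ ∈ regFibrePr F J K hJK.le e V → IsCritR2 F J K hJK.le V U₀ →
        wilsonAction4 U₀ = minActionRegPr F J K hJK.le ε₀ V →
        (∀ᶠ W in 𝓝 U₀, ContinuousAt (descendTo F ℰp J K hJK.le) W) →
        (∀ s : Site (F.P J) 0 → Matrix (Fin 2) (Fin 2) ℂ,
          (∀ b : PBond (F.P J) 0, s b.src * (V b : Matrix (Fin 2) (Fin 2) ℂ) = (V b : Matrix (Fin 2) (Fin 2) ℂ) * s b.tgt) →
            ∃ c : ℂ, ∀ x, s x = c • (1 : Matrix (Fin 2) (Fin 2) ℂ)) →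
        ∀ (ρ₀ Kπ : ℝ), 0 < ρ₀ → 0 ≤ Kπ →
        (∀ (B : GaugeField (F.P K) 0 (Matrix.specialUnitaryGroup (Fin 2) ℂ)) (ρ : ℝ), 0 ≤ ρ → ρ ≤ ρ₀ →
          (∀ ℓ : PBond (F.P K) 0, ‖(U₀ ℓ : Matrix (Fin 2) (Fin 2) ℂ) - (B ℓ : Matrix (Fin 2) (Fin 2) ℂ)‖ ≤ ρ) →
          ∀ b : PBond (F.P J) 0,
            ‖((descendTo F ℰp J K hJK.le U₀ b : Matrix.specialUnitaryGroup (Fin 2) ℂ) : Matrix (Fin 2) (Fin 2) ℂ) -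
                ((descendTo F ℰp J K hJK.le B b : Matrix.specialUnitaryGroup (Fin 2) ℂ) : Matrix (Fin 2) (Fin 2) ℂ)‖ ≤ Kπ * ρ) →
        (∀ U ∈ closure (fibre F ℰp J K hJK.le V ∩ histGood F ℰp (θBal F.L γ b₀ p₀) K J),
            (∃ w : Site (F.P K) 0 → Matrix.specialUnitaryGroup (Fin 2) ℂ,
              (∀ U'' : GaugeField (F.P K) 0 (Matrix.specialUnitaryGroup (Fin 2) ℂ),
                  descendTo F ℰp J K hJK.le (GaugeField.gaugeAct w U'') = descendTo F ℰp J K hJK.le U'') ∧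
                ∀ ℓ : PBond (F.P K) 0, dist1 (U ℓ * ((GaugeField.gaugeAct w U₀) ℓ)⁻¹) ≤ δ) →
            wilsonAction4 U ≤ minActionRegPr F J K hJK.le ε₀ V →
            (⨅ w : {w : Site (F.P K) 0 → Matrix.specialUnitaryGroup (Fin 2) ℂ |
                ∀ U : GaugeField (F.P K) 0 (Matrix.specialUnitaryGroup (Fin 2) ℂ),
                  descendTo F ℰp J K hJK.le (GaugeField.gaugeAct w U) = descendTo F ℰp J K hJK.le U},
              ∑ ℓ : PBond (F.P K) 0,
                dist1 (U ℓ * ((GaugeField.gaugeAct (w : Site (F.P K) 0 → Matrix.specialUnitaryGroup (Fin 2) ℂ) U₀) ℓ)⁻¹) ^ 2) = 0) →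
        ∃ μ : ℝ, 0 < μ ∧ ∀ U ∈ fibre F ℰp J K hJK.le V, U ∈ histGood F ℰp (θBal F.L γ b₀ p₀) K J →
          (∃ w : Site (F.P K) 0 → Matrix.specialUnitaryGroup (Fin 2) ℂ,
            (∀ U'' : GaugeField (F.P K) 0 (Matrix.specialUnitaryGroup (Fin 2) ℂ),
                descendTo F ℰp J K hJK.le (GaugeField.gaugeAct w U'') = descendTo F ℰp J K hJK.le U'') ∧
              ∀ ℓ : PBond (F.P K) 0, dist1 (U ℓ * ((GaugeField.gaugeAct w U₀) ℓ)⁻¹) ≤ δ) →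
          μ * ((F.L : ℝ)⁻¹) ^ (2 * (K - J)) *
              (⨅ w : {w : Site (F.P K) 0 → Matrix.specialUnitaryGroup (Fin 2) ℂ |
                  ∀ U : GaugeField (F.P K) 0 (Matrix.specialUnitaryGroup (Fin 2) ℂ),
                    descendTo F ℰp J K hJK.le (GaugeField.gaugeAct w U) = descendTo F ℰp J K hJK.le U},
                ∑ ℓ : PBond (F.P K) 0,
                  dist1 (U ℓ * ((GaugeField.gaugeAct (w : Site (F.P K) 0 → Matrix.specialUnitaryGroup (Fin 2) ℂ) U₀) ℓ)⁻¹) ^ 2)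
            ≤ wilsonAction4 U - minActionRegPr F J K hJK.le ε₀ V := by
  obtain ⟨e₈, he₈, H⟩ := growthOn_nhds_at_isCritR2_of_irr_five L h5
  refine ⟨e₈, he₈, ?_⟩
  intro F hF J K hJK e γ b₀ p₀ ε₀ V U₀ δ he heε hU₀reg hcrit hmin hcont hirr ρ₀ Kπ hρ₀ hKπ hLip hisol
  obtain ⟨N, hN, c, hc, hgrowN⟩ := H F hF J K hJK e γ b₀ p₀ ε₀ V U₀ he heε hU₀reg hcrit hmin hcont hirr ρ₀ Kπ hρ₀ hKπ hLip
  exact tubeGrowth_of_growthOn_nhds_of_isolated F hJK.le V U₀ δ hN hc hgrowN hisol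

end Assembly


end Summit.QuantumFields.YangMills.Theorems.FluctuationComparisonRegPrIntLS2BetaPosCollarAtIrreducible

end
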